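import Summits.NavierStokesRegularity.NavierStokesRegularity.Theses.WakeRatchet
import Summits.NavierStokesRegularity.NavierStokesRegularity.Theorems.WakeRatchetEternalViscousRateViscDSSLoud

/-!
# LINE g9-2 corollary 2 — non-trivial bounded admissible viscous eternal solutions are LOUD IN THE FAR PAST

Ideator ns-idea-1 g9 (card «monotone quantity hunt»).  MODEL lattice only; no summit is proved here.

`loudPast` — let `W` be a uniformly bounded admissible viscous eternal solution of the renormalised Tao lattice
(`ν̂ > 0`, `ε₀ ∈ (0,1]`, cancelling table) with `W ≢ 0`.  Then there is a shell `N` such that for every base shell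
`n ≤ N` and every tail bound `M` (`Σ_{k≥0} E_{n+k}(σ) ≤ M` for all `σ`) the NORMALISED dissipation number is
above the edge threshold: `(1+ε₀)^n · M > ν̂²/(128 (C_A+1)²)`.  In physical terms the tail energies satisfy
`M_n ≥ c ν̂² (1+ε₀)^{-n} → ∞` as `n → −∞`: an eternal viscous solution is FORCED to carry a quantitatively
infinite-energy, dissipation-dominating past (the «reservoir at n = −∞» of the g7 dead end, now with a floor).
Mechanism: quiet at base `n` (normalised bound below threshold) ⇒ by the self-propagating rung (`climb`,
transported to base `n` by `shiftFactor_intCast = (1+ε₀)^n`) every higher shell obeys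
`E_{n+j}(τ) ≤ M (1+ε₀)^{-2j} ≤ threshold·(1+ε₀)^{n-2(n+j)}`, which tends to `0` as `n → −∞` for fixed `n+j = m₀`;
a non-zero value `E_{m₀}(σ₀) > 0` therefore forbids quietness at all sufficiently negative `n`.
The block-DSS corollary (`viscdss_loud.lean`) is the periodic special case.
[cite: Tao2016AveragedNS, §4 Lemma 4.1 and §6.4; tree: physEnergy_succ_le, isEternalVisc_shift]
-/

noncomputable section

set_option linter.dupNamespace false

namespace Summit.NavierStokesRegularity.NavierStokesRegularity.Cruxes.EternalViscousRate.DissipationEdge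

open Set Filter Topology
open Literature.Analysis.FluidPDE Literature.Analysis.FluidPDE.TaoCascade

/-! ## Integer base shells -/

/-- At the covariant lag and an INTEGER base shell, the shift factor is `(1+ε₀)^n` (zpow). -/
theorem shiftFactor_intCast {ε₀ : ℝ} (hε : 0 < ε₀) (n : ℤ) :
    shiftFactor ε₀ n (2 * (n : ℝ) * Real.log (1 + ε₀)) = (1 + ε₀) ^ n := by
  have hb : 0 < 1 + ε₀ := by linarith
  unfold shiftFactor bigLam
  have h1 : ((1 + ε₀) ^ ((5 : ℝ) / 2)) ^ n = (1 + ε₀) ^ ((5 : ℝ) / 2 * (n : ℝ)) := by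
    rw [← Real.rpow_intCast, ← Real.rpow_mul hb.le]
  have h2 : ((1 + ε₀) ^ ((5 : ℝ) / 2 * (n : ℝ))) ^ 2 = (1 + ε₀) ^ ((5 : ℝ) / 2 * (n : ℝ) * 2) := by
    rw [← Real.rpow_natCast, ← Real.rpow_mul hb.le]; norm_num
  have h3 : Real.exp (-(2 * (2 * (n : ℝ) * Real.log (1 + ε₀)))) = (1 + ε₀) ^ (-(4 * (n : ℝ))) := by
    rw [Real.rpow_def_of_pos hb]; congr 1; ring
  rw [h1, h2, h3, ← Real.rpow_add hb, ← Real.rpow_intCast]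
  congr 1; ring

/-- **Quiet base shell ⇒ super-survival decay above it.** If at base shell `n ∈ ℤ` the tail admits a bound `M`
with normalised dissipation number below threshold, `(1+ε₀)^n M ≤ ν̂²/(128 (C_A+1)²)`, then every higher
shell obeys `E_{n+j}(τ) ≤ M (1+ε₀)^{-2j}`. -/
theorem quiet_decay {ε₀ : ℝ} (hε : 0 < ε₀) (hε1 : ε₀ ≤ 1)
    {α : Fin 4 → Fin 4 → Fin 4 → ℤ × ℤ × ℤ → ℝ} (hc : IsCancellingCoeff α) {νh : ℝ} (hν : 0 < νh)
    {W : ℤ → ℝ → Em 4} (hW : IsEternalVisc ε₀ νh α W) (hUB : UniformBound W) (n : ℤ) {M : ℝ}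
    (hq : (1 + ε₀) ^ n * M ≤ edgeThreshold α νh)
    (hT : ∀ σ : ℝ, ∑' k : ℕ, physEnergy ε₀ W (n + k) σ ≤ M) :
    ∀ (j : ℕ) (τ : ℝ), physEnergy ε₀ W (n + j) τ ≤ M * (((1 + ε₀) ^ 2)⁻¹) ^ j := by
  have hvis := isEternalVisc_shift (m := 4) (by linarith : -1 < ε₀) hW n
  have hWt : ∀ j τ, (fun j τ => W (j + n) (τ + 2 * (n : ℝ) * Real.log (1 + ε₀))) j τ
      = W (j + n) (τ + 2 * (n : ℝ) * Real.log (1 + ε₀)) := fun _ _ => rfl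
  obtain ⟨B, hB⟩ := hUB
  have hBt : ∀ (k : ℤ) (τ : ℝ),
      ‖(fun j τ => W (j + n) (τ + 2 * (n : ℝ) * Real.log (1 + ε₀))) k τ‖ ≤ B := fun k τ => hB _ _
  have hUBt : UniformBound (fun j τ => W (j + n) (τ + 2 * (n : ℝ) * Real.log (1 + ε₀))) := ⟨B, hBt⟩
  have hρ := shiftFactor_pos hε n (2 * (n : ℝ) * Real.log (1 + ε₀))
  have hρeq := shiftFactor_intCast hε n
  have hMt : ∀ τ : ℝ, ∑' k : ℕ,
      physEnergy ε₀ (fun j τ => W (j + n) (τ + 2 * (n : ℝ) * Real.log (1 + ε₀))) (0 + k) τ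
        ≤ shiftFactor ε₀ n (2 * (n : ℝ) * Real.log (1 + ε₀)) * M := by
    intro τ
    have hc' : ∀ k : ℕ,
        physEnergy ε₀ (fun j τ => W (j + n) (τ + 2 * (n : ℝ) * Real.log (1 + ε₀))) (0 + k) τ
          = shiftFactor ε₀ n (2 * (n : ℝ) * Real.log (1 + ε₀))
            * physEnergy ε₀ W (n + k) (τ + 2 * (n : ℝ) * Real.log (1 + ε₀)) := by
      intro k
      rw [physEnergy_shellShift hε hWt, show (0 : ℤ) + (k : ℤ) + n = n + k by ring]
    rw [tsum_congr hc', tsum_mul_left]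
    exact mul_le_mul_of_nonneg_left (hT _) hρ.le
  have hMθ : shiftFactor ε₀ n (2 * (n : ℝ) * Real.log (1 + ε₀)) * M ≤ edgeThreshold α νh := by
    rw [hρeq]; exact hq
  have hcl := climb hε hε1 hc hν hvis hUBt hMθ hMt
  intro j τ
  have hsumm := summable_physEnergy_tail hε hBt (j : ℤ) (τ - 2 * (n : ℝ) * Real.log (1 + ε₀))
  have h0 := hsumm.le_tsum 0 (fun i _ => physEnergy_nonneg ε₀ _ _ _)
  have h1 : physEnergy ε₀ (fun j τ => W (j + n) (τ + 2 * (n : ℝ) * Real.log (1 + ε₀)))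
      ((j : ℤ) + ((0 : ℕ) : ℤ)) (τ - 2 * (n : ℝ) * Real.log (1 + ε₀))
        = shiftFactor ε₀ n (2 * (n : ℝ) * Real.log (1 + ε₀)) * physEnergy ε₀ W (n + j) τ := by
    rw [physEnergy_shellShift hε hWt, show (j : ℤ) + ((0 : ℕ) : ℤ) + n = n + j by push_cast; ring,
      show τ - 2 * (n : ℝ) * Real.log (1 + ε₀) + 2 * (n : ℝ) * Real.log (1 + ε₀) = τ by ring]
  rw [h1] at h0
  have h2 := hcl j (τ - 2 * (n : ℝ) * Real.log (1 + ε₀))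
  refine le_of_mul_le_mul_left ?_ hρ
  calc shiftFactor ε₀ n (2 * (n : ℝ) * Real.log (1 + ε₀)) * physEnergy ε₀ W (n + j) τ
      ≤ _ := h0
    _ ≤ shiftFactor ε₀ n (2 * (n : ℝ) * Real.log (1 + ε₀)) * M * (((1 + ε₀) ^ 2)⁻¹) ^ j := h2
    _ = _ := by ring

/-- **Loud past.**  A non-trivial uniformly bounded admissible viscous eternal solution (`ν̂ > 0`, `ε₀ ∈ (0,1]`,
cancelling table) has, at every sufficiently negative base shell `n`, normalised dissipation number ABOVE the
dissipation-edge threshold for every tail bound: `(1+ε₀)^n M > ν̂²/(128 (C_A+1)²)`.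
[cite: Tao2016AveragedNS, §4 Lemma 4.1 and §6.4; LINE g9-2 rung + covariance] -/
theorem loudPast {ε₀ : ℝ} (hε : 0 < ε₀) (hε1 : ε₀ ≤ 1)
    {α : Fin 4 → Fin 4 → Fin 4 → ℤ × ℤ × ℤ → ℝ} (hc : IsCancellingCoeff α) {νh : ℝ} (hν : 0 < νh)
    {W : ℤ → ℝ → Em 4} (hW : IsEternalVisc ε₀ νh α W) (hUB : UniformBound W)
    (hne : ∃ (n : ℤ) (σ : ℝ), W n σ ≠ 0) :
    ∃ N : ℤ, ∀ n : ℤ, n ≤ N → ∀ M : ℝ, (∀ σ : ℝ, ∑' k : ℕ, physEnergy ε₀ W (n + k) σ ≤ M) →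
      edgeThreshold α νh < (1 + ε₀) ^ n * M := by
  obtain ⟨m₀, σ₀, hne⟩ := hne
  have hb : 0 < 1 + ε₀ := by linarith
  have hb1 : 1 < 1 + ε₀ := by linarith
  have hΛ : 0 < bigLam ε₀ ^ m₀ := zpow_pos (bigLam_pos (by linarith)) m₀
  have hE : 0 < physEnergy ε₀ W m₀ σ₀ := by
    unfold physEnergy
    have hn : 0 < ‖W m₀ σ₀‖ := norm_pos_iff.mpr hne
    positivity
  have hθ : 0 < edgeThreshold α νh := by
    unfold edgeThreshold
    have h1 : 0 < fluxConst α + 1 := by linarith [fluxConst_nonneg α]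
    exact div_pos (pow_pos hν 2) (mul_pos (by norm_num) (pow_pos h1 2))
  -- a natural number k with θ·(1+ε₀)^{-k} < E
  obtain ⟨k, hk⟩ := exists_pow_lt_of_lt_one (div_pos hE hθ) (inv_lt_one_of_one_lt₀ hb1)
  refine ⟨min m₀ (2 * m₀ - k), fun n hn M hM => ?_⟩
  have hn1 : n ≤ m₀ := le_trans hn (min_le_left _ _)
  have hn2 : n ≤ 2 * m₀ - k := le_trans hn (min_le_right _ _)
  by_contra hquiet
  push Not at hquiet
  have hdec := quiet_decay hε hε1 hc hν hW hUB n hquiet hM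
  obtain ⟨j, hj⟩ := Int.eq_ofNat_of_zero_le (show (0 : ℤ) ≤ m₀ - n by omega)
  have hEle := hdec j σ₀
  rw [show n + (j : ℤ) = m₀ by omega] at hEle
  have hpn : 0 < (1 + ε₀) ^ n := zpow_pos hb n
  have hM' : M ≤ edgeThreshold α νh / (1 + ε₀) ^ n := by
    rw [le_div_iff₀ hpn, mul_comm]; exact hquiet
  have hr : (((1 + ε₀) ^ 2)⁻¹) ^ j = (1 + ε₀) ^ (-(2 * (j : ℤ))) := by
    rw [inv_pow, ← pow_mul, zpow_neg, show (2 * (j : ℤ)) = ((2 * j : ℕ) : ℤ) by push_cast; ring,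
      zpow_natCast]
  have hcomb : M * (((1 + ε₀) ^ 2)⁻¹) ^ j ≤ edgeThreshold α νh * (1 + ε₀) ^ (n - 2 * m₀) := by
    calc M * (((1 + ε₀) ^ 2)⁻¹) ^ j
        ≤ edgeThreshold α νh / (1 + ε₀) ^ n * (((1 + ε₀) ^ 2)⁻¹) ^ j :=
          mul_le_mul_of_nonneg_right hM' (by positivity)
      _ = edgeThreshold α νh * (((1 + ε₀) ^ n)⁻¹ * (1 + ε₀) ^ (-(2 * (j : ℤ)))) := by rw [hr]; ring
      _ = edgeThreshold α νh * (1 + ε₀) ^ (n - 2 * m₀) := by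
          congr 1
          rw [← zpow_neg, ← zpow_add₀ hb.ne']
          congr 1
          omega
  have hmono : (1 + ε₀) ^ (n - 2 * m₀) ≤ (1 + ε₀) ^ (-(k : ℤ)) :=
    zpow_le_zpow_right₀ hb1.le (by omega)
  have hk' : edgeThreshold α νh * (1 + ε₀) ^ (-(k : ℤ)) < physEnergy ε₀ W m₀ σ₀ := by
    rw [zpow_neg, zpow_natCast, ← inv_pow]
    have := (lt_div_iff₀ hθ).mp hk
    linarith [this]
  have : physEnergy ε₀ W m₀ σ₀ < physEnergy ε₀ W m₀ σ₀ :=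
    calc physEnergy ε₀ W m₀ σ₀ ≤ M * (((1 + ε₀) ^ 2)⁻¹) ^ j := hEle
      _ ≤ edgeThreshold α νh * (1 + ε₀) ^ (n - 2 * m₀) := hcomb
      _ ≤ edgeThreshold α νh * (1 + ε₀) ^ (-(k : ℤ)) := mul_le_mul_of_nonneg_left hmono hθ.le
      _ < physEnergy ε₀ W m₀ σ₀ := hk'
  exact lt_irrefl _ this

end Summit.NavierStokesRegularity.NavierStokesRegularity.Cruxes.EternalViscousRate.DissipationEdge

end
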